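import Literature.MathematicalPhysics.QuantumFieldTheory.Balaban1983to89.B16Ineq17NearFlatWilsonLetters

/-!
# `Balaban1983to89.B16Ineq17NearFlatWilsonLettersLocal` — [Balaban1989LargeFieldII] (1.7) pp. 357–358 at a NEAR-FLAT background, one-sided: THE LOCALISED EDITION of this seat's Wilson-letter
# assembly (`B16Ineq17NearFlatWilsonLetters`, p599997) — the letter (δ₁) and the skeleton `hessian_wilsonAction4_criticalExpChartFamily_ge_flatMin_sub` with the background assumed `δ`-near-flat
# ONLY on the plaquettes meeting the support of the family's velocity (print: «U₀ = exp iξA₀ with A₀ small ON THE DOMAIN Z», p. 357)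

Honest framing: statement-level skeleton of published theorems with citation tags; proofs where landed; nothing here is a claim about the Yang–Mills mass gap.  Cell `pub-ymgap`, HUMAN RULING
D-0062 ∕ D-0149, width seat `pub-ymgap-dag-n12-w4` generation 3 (lane U2c; the lane owner's word (r1) of 2026-08-28 after dag-n12-w5 g3's LOCATED-hU: the assembled endpoint's GLOBAL near-flatness
binder `hU : ∀ b, ‖↑U₀ b − 1‖ ≤ δ` is NOT inhabitable at the record's `U₀`, which is pinned to the raw base field far from `Z`; the letters must be localised to the support of the variation).  Key
K1⁷ `stmt-QuantumFields-20542`, helper, count-neutral.  CONSUMED BY NAME: dag-n12-w2's plaquette-budget letter `Node00.WilsonActionSecondVariationNearFlat.abs_deriv_deriv_wilsonAction4_expChart_sub_flat_le_local`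
(p587195) and incidence count `Node00.…L2Letters.sum_plaq_boundary_sq_le` (p593907), this seat's p599997 (`letter_beta_wilson`) and p598593 (`hessian_value_criticalFamily_ge_flatMin_sub_seminorm`), w3's
`B11Eq177CriticalFamilyDerivative` calculus.

CONTENTS (theorems only — no `def`, no `instance`, no `sorry`).
* §1 ★ `abs_deriv_deriv_wilsonAction4_expChart_sub_flat_le_l2_local` — RIGHT chart `U·e^{sX}`: `X` supported in `B₀` and `‖↑U_b − 1‖ ≤ δ` on the four bonds of every plaquette MEETING `B₀` ⇒
  `|d²A(U·e^{sX}) − d²A(e^{sX})| ≤ 32(d−1)δ·Σ_b‖X_b‖²` (the constant of the global edition; dag-n12-w2's LEFT-chart local edition has `64(d−1)`).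
* §2 ★ `letter_delta1_wilson_local` — the (δ₁) binder of the skeleton at a direction `w` supported in `B₀`, under LOCAL near-flatness.
* §3 ★★★ `hessian_wilsonAction4_criticalExpChartFamily_ge_flatMin_sub_local` — p599997's skeleton VERBATIM except `hU` ↦ (`B₀`, `hsupp : ∀ b ∉ B₀, X′h b = 0`, local `hU`, `0 ≤ δ`): the input named by
  dag-n12-c for the assembled endpoint's v1.2.

HONEST SCOPE: the same elementary calculus as p599997 with the plaquette sum split at the support; nothing of Bałaban's asserted; N12 NOT discharged; K1⁷ NOT closed; counts unmoved (5∕27); one finite 𝕋⁴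
programme at fixed ε — R4 closes the conditional rung `BalabanLadder.UV` only; NOT continuum ∕ ℝ⁴ ∕ OS ∕ mass gap ∕ Clay.
-/

noncomputable section

open Filter Topology Set
open scoped Topology BigOperators

namespace Literature.MathematicalPhysics.QuantumFieldTheory.Balaban1983to89.B16Ineq17NearFlatWilsonLettersLocal

open T4Continuum B15DeterminingSets
open T4AdjointCovarianceUnitary (lieSU)
open Node00
open scoped Matrix.Norms.L2Operator
open B11Eq177CriticalFamilyDerivative (contDiff_wilsonAction4_expChart hasFDerivAt_fderiv_wilsonAction4_expChart deriv_deriv_wilsonAction4_expChart_smul_eq)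
open B16Ineq17NearFlatOneSidedSeminorm (hessian_value_criticalFamily_ge_flatMin_sub_seminorm)
open B16Ineq17NearFlatWilsonLetters (letter_beta_wilson)

variable {P : Params} {j : ℕ} {N : ℕ} [NeZero N]

omit [NeZero N] in
/-- Off the plaquettes meeting `B₀` the four letters of a field supported in `B₀` vanish. [folklore] [cite: Balaban1989LargeFieldII, p.357 (bookkeeping)] -/
private theorem meets_or_vanish (X : PBond P j → lieSU (Fin N)) (B₀ : Set (PBond P j)) (hX : ∀ b ∉ B₀, X b = 0) (p : Plaq P j)
    (h : ¬ ((⟨p.src, p.μ⟩ : PBond P j) ∈ B₀ ∨ (⟨p.src.shift p.μ, p.ν⟩ : PBond P j) ∈ B₀ ∨ (⟨p.src.shift p.ν, p.μ⟩ : PBond P j) ∈ B₀ ∨ (⟨p.src, p.ν⟩ : PBond P j) ∈ B₀)) :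
    ‖(X ⟨p.src, p.μ⟩ : Matrix (Fin N) (Fin N) ℂ)‖ + ‖(X ⟨p.src.shift p.μ, p.ν⟩ : Matrix (Fin N) (Fin N) ℂ)‖
      + ‖(X ⟨p.src.shift p.ν, p.μ⟩ : Matrix (Fin N) (Fin N) ℂ)‖ + ‖(X ⟨p.src, p.ν⟩ : Matrix (Fin N) (Fin N) ℂ)‖ = 0 := by
  simp only [not_or] at h
  obtain ⟨h1, h2, h3, h4⟩ := h
  rw [hX _ h1, hX _ h2, hX _ h3, hX _ h4]
  simp

/-! ## §1  The second variation at a LOCALLY near-flat background vs the flat one, in `ℓ²(bonds)` -/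

/-- ★ **LETTER (b) IN `ℓ²(bonds)`, LOCALISED (right chart)**: if `X` vanishes off `B₀` and `‖↑U_b − 1‖ ≤ δ` on the four bonds of every plaquette meeting `B₀`, then
`|d²∕ds² A(U·e^{sX})∣₀ − d²∕ds² A(1·e^{sX})∣₀| ≤ 32(d−1)δ·Σ_b‖X_b‖²` — dag-n12-w2's plaquette-budget form with budget `δ` on the plaquettes meeting `B₀` and `2` elsewhere (where the four
letters of `X` vanish, so the budget is immaterial). [cite: Balaban1989LargeFieldII, p.357 («A₀ small on the domain Z»), (1.7) p.358; Balaban1985BackgroundPropagators, (3.10) p.392] -/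
theorem abs_deriv_deriv_wilsonAction4_expChart_sub_flat_le_l2_local (U : GaugeField P j (SU N)) (X : PBond P j → lieSU (Fin N)) (B₀ : Set (PBond P j))
    (hX : ∀ b ∉ B₀, X b = 0) {δ : ℝ} (hδ0 : 0 ≤ δ)
    (hU : ∀ p : Plaq P j, ((⟨p.src, p.μ⟩ : PBond P j) ∈ B₀ ∨ (⟨p.src.shift p.μ, p.ν⟩ : PBond P j) ∈ B₀ ∨ (⟨p.src.shift p.ν, p.μ⟩ : PBond P j) ∈ B₀ ∨ (⟨p.src, p.ν⟩ : PBond P j) ∈ B₀) →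
      ‖(U ⟨p.src, p.μ⟩ : Matrix (Fin N) (Fin N) ℂ) - 1‖ ≤ δ ∧ ‖(U ⟨p.src.shift p.μ, p.ν⟩ : Matrix (Fin N) (Fin N) ℂ) - 1‖ ≤ δ
        ∧ ‖(U ⟨p.src.shift p.ν, p.μ⟩ : Matrix (Fin N) (Fin N) ℂ) - 1‖ ≤ δ ∧ ‖(U ⟨p.src, p.ν⟩ : Matrix (Fin N) (Fin N) ℂ) - 1‖ ≤ δ) :
    |deriv (deriv fun s : ℝ => wilsonAction4 (expChart U (s • X))) 0 - deriv (deriv fun s : ℝ => wilsonAction4 (expChart 1 (s • X))) 0|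
      ≤ 32 * ((P.d : ℝ) - 1) * δ * ∑ b : PBond P j, ‖(X b : Matrix (Fin N) (Fin N) ℂ)‖ ^ 2 := by
  classical
  -- budget: `δ` on the plaquettes meeting `B₀`, `2` elsewhere
  let bud : Plaq P j → ℝ := fun p =>
    if ((⟨p.src, p.μ⟩ : PBond P j) ∈ B₀ ∨ (⟨p.src.shift p.μ, p.ν⟩ : PBond P j) ∈ B₀ ∨ (⟨p.src.shift p.ν, p.μ⟩ : PBond P j) ∈ B₀ ∨ (⟨p.src, p.ν⟩ : PBond P j) ∈ B₀) then δ else 2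
  have htwo : ∀ b : PBond P j, ‖(U b : Matrix (Fin N) (Fin N) ℂ) - 1‖ ≤ 2 := fun b => by
    calc ‖(U b : Matrix (Fin N) (Fin N) ℂ) - 1‖ ≤ ‖(U b : Matrix (Fin N) (Fin N) ℂ)‖ + ‖(1 : Matrix (Fin N) (Fin N) ℂ)‖ := norm_sub_le _ _
      _ ≤ 1 + 1 := by
          gcongr
          · exact (CStarRing.norm_of_mem_unitary (U b).2.1).le
          · exact norm_one.le
      _ = 2 := by norm_num
  have hbud : ∀ p : Plaq P j, ‖(U ⟨p.src, p.μ⟩ : Matrix (Fin N) (Fin N) ℂ) - 1‖ ≤ bud p ∧ ‖(U ⟨p.src.shift p.μ, p.ν⟩ : Matrix (Fin N) (Fin N) ℂ) - 1‖ ≤ bud p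
      ∧ ‖(U ⟨p.src.shift p.ν, p.μ⟩ : Matrix (Fin N) (Fin N) ℂ) - 1‖ ≤ bud p ∧ ‖(U ⟨p.src, p.ν⟩ : Matrix (Fin N) (Fin N) ℂ) - 1‖ ≤ bud p := by
    intro p
    by_cases h : ((⟨p.src, p.μ⟩ : PBond P j) ∈ B₀ ∨ (⟨p.src.shift p.μ, p.ν⟩ : PBond P j) ∈ B₀ ∨ (⟨p.src.shift p.ν, p.μ⟩ : PBond P j) ∈ B₀ ∨ (⟨p.src, p.ν⟩ : PBond P j) ∈ B₀)
    · have hb : bud p = δ := if_pos h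
      rw [hb]; exact hU p h
    · have hb : bud p = 2 := if_neg h
      rw [hb]; exact ⟨htwo _, htwo _, htwo _, htwo _⟩
  have hmain := abs_deriv_deriv_wilsonAction4_expChart_sub_flat_le_local U X bud hbud
  -- replace the budget by `δ` termwise: off the plaquettes meeting `B₀` the four letters vanish
  have hterm : ∀ p : Plaq P j,
      bud p * (‖(X ⟨p.src, p.μ⟩ : Matrix (Fin N) (Fin N) ℂ)‖ + ‖(X ⟨p.src.shift p.μ, p.ν⟩ : Matrix (Fin N) (Fin N) ℂ)‖
          + ‖(X ⟨p.src.shift p.ν, p.μ⟩ : Matrix (Fin N) (Fin N) ℂ)‖ + ‖(X ⟨p.src, p.ν⟩ : Matrix (Fin N) (Fin N) ℂ)‖) ^ 2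
        ≤ δ * (‖(X ⟨p.src, p.μ⟩ : Matrix (Fin N) (Fin N) ℂ)‖ + ‖(X ⟨p.src.shift p.μ, p.ν⟩ : Matrix (Fin N) (Fin N) ℂ)‖
          + ‖(X ⟨p.src.shift p.ν, p.μ⟩ : Matrix (Fin N) (Fin N) ℂ)‖ + ‖(X ⟨p.src, p.ν⟩ : Matrix (Fin N) (Fin N) ℂ)‖) ^ 2 := by
    intro p
    by_cases h : ((⟨p.src, p.μ⟩ : PBond P j) ∈ B₀ ∨ (⟨p.src.shift p.μ, p.ν⟩ : PBond P j) ∈ B₀ ∨ (⟨p.src.shift p.ν, p.μ⟩ : PBond P j) ∈ B₀ ∨ (⟨p.src, p.ν⟩ : PBond P j) ∈ B₀)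
    · have hb : bud p = δ := if_pos h
      rw [hb]
    · rw [meets_or_vanish X B₀ hX p h]
      simp
  calc |deriv (deriv fun s : ℝ => wilsonAction4 (expChart U (s • X))) 0 - deriv (deriv fun s : ℝ => wilsonAction4 (expChart 1 (s • X))) 0|
      ≤ 4 * ∑ p : Plaq P j, bud p * (‖(X ⟨p.src, p.μ⟩ : Matrix (Fin N) (Fin N) ℂ)‖ + ‖(X ⟨p.src.shift p.μ, p.ν⟩ : Matrix (Fin N) (Fin N) ℂ)‖
          + ‖(X ⟨p.src.shift p.ν, p.μ⟩ : Matrix (Fin N) (Fin N) ℂ)‖ + ‖(X ⟨p.src, p.ν⟩ : Matrix (Fin N) (Fin N) ℂ)‖) ^ 2 := hmain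
    _ ≤ 4 * ∑ p : Plaq P j, δ * (‖(X ⟨p.src, p.μ⟩ : Matrix (Fin N) (Fin N) ℂ)‖ + ‖(X ⟨p.src.shift p.μ, p.ν⟩ : Matrix (Fin N) (Fin N) ℂ)‖
          + ‖(X ⟨p.src.shift p.ν, p.μ⟩ : Matrix (Fin N) (Fin N) ℂ)‖ + ‖(X ⟨p.src, p.ν⟩ : Matrix (Fin N) (Fin N) ℂ)‖) ^ 2 := by
        exact mul_le_mul_of_nonneg_left (Finset.sum_le_sum fun p _ => hterm p) (by norm_num)
    _ = 4 * δ * ∑ p : Plaq P j, (‖(X ⟨p.src, p.μ⟩ : Matrix (Fin N) (Fin N) ℂ)‖ + ‖(X ⟨p.src.shift p.μ, p.ν⟩ : Matrix (Fin N) (Fin N) ℂ)‖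
          + ‖(X ⟨p.src.shift p.ν, p.μ⟩ : Matrix (Fin N) (Fin N) ℂ)‖ + ‖(X ⟨p.src, p.ν⟩ : Matrix (Fin N) (Fin N) ℂ)‖) ^ 2 := by
        rw [← Finset.mul_sum]; ring
    _ ≤ 4 * δ * (8 * ((P.d : ℝ) - 1) * ∑ b : PBond P j, ‖(X b : Matrix (Fin N) (Fin N) ℂ)‖ ^ 2) :=
        mul_le_mul_of_nonneg_left (sum_plaq_boundary_sq_le fun b => ‖(X b : Matrix (Fin N) (Fin N) ℂ)‖) (by positivity)
    _ = 32 * ((P.d : ℝ) - 1) * δ * ∑ b : PBond P j, ‖(X b : Matrix (Fin N) (Fin N) ℂ)‖ ^ 2 := by ring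

/-! ## §2  The letter (δ₁), localised -/

/-- ★ **THE LETTER (δ₁) AT A DIRECTION SUPPORTED IN `B₀`, UNDER LOCAL NEAR-FLATNESS**: for a seminorm `p` dominating the `ℓ²(bonds)` operator-norm sum, `w` vanishing off `B₀` and `U₀` `δ`-near-flat
on the plaquettes meeting `B₀`: `D²(A∘expChart 1)(0)(w,w) − 32(d−1)δ·p(w)² ≤ D²(A∘expChart U₀)(0)(w,w)`. [cite: Balaban1989LargeFieldII, p.357, (1.7) p.358; Balaban1985BackgroundPropagators, (3.10) p.392] -/
theorem letter_delta1_wilson_local (U₀ : GaugeField P j (SU N)) (B₀ : Set (PBond P j)) {δ : ℝ} (hδ0 : 0 ≤ δ)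
    (hU : ∀ p : Plaq P j, ((⟨p.src, p.μ⟩ : PBond P j) ∈ B₀ ∨ (⟨p.src.shift p.μ, p.ν⟩ : PBond P j) ∈ B₀ ∨ (⟨p.src.shift p.ν, p.μ⟩ : PBond P j) ∈ B₀ ∨ (⟨p.src, p.ν⟩ : PBond P j) ∈ B₀) →
      ‖(U₀ ⟨p.src, p.μ⟩ : Matrix (Fin N) (Fin N) ℂ) - 1‖ ≤ δ ∧ ‖(U₀ ⟨p.src.shift p.μ, p.ν⟩ : Matrix (Fin N) (Fin N) ℂ) - 1‖ ≤ δ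
        ∧ ‖(U₀ ⟨p.src.shift p.ν, p.μ⟩ : Matrix (Fin N) (Fin N) ℂ) - 1‖ ≤ δ ∧ ‖(U₀ ⟨p.src, p.ν⟩ : Matrix (Fin N) (Fin N) ℂ) - 1‖ ≤ δ)
    (p : Seminorm ℝ (PBond P j → lieSU (Fin N))) (hp : ∀ X : PBond P j → lieSU (Fin N), ∑ b, ‖(X b : Matrix (Fin N) (Fin N) ℂ)‖ ^ 2 ≤ p X ^ 2)
    (w : PBond P j → lieSU (Fin N)) (hw : ∀ b ∉ B₀, w b = 0) :
    fderiv ℝ (fun Y => fderiv ℝ (fun Y : PBond P j → lieSU (Fin N) => wilsonAction4 (expChart (1 : GaugeField P j (SU N)) Y)) Y) 0 w w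
        - 32 * ((P.d : ℝ) - 1) * δ * p w ^ 2
      ≤ fderiv ℝ (fun Y => fderiv ℝ (fun Y : PBond P j → lieSU (Fin N) => wilsonAction4 (expChart U₀ Y)) Y) 0 w w := by
  have hd : 0 ≤ (P.d : ℝ) - 1 := by
    have := P.hd
    have h1 : (1 : ℝ) ≤ P.d := by exact_mod_cast this
    linarith
  have h := abs_deriv_deriv_wilsonAction4_expChart_sub_flat_le_l2_local U₀ w B₀ hw hδ0 hU
  rw [deriv_deriv_wilsonAction4_expChart_smul_eq U₀ w, deriv_deriv_wilsonAction4_expChart_smul_eq 1 w] at h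
  have h2 : 32 * ((P.d : ℝ) - 1) * δ * ∑ b, ‖(w b : Matrix (Fin N) (Fin N) ℂ)‖ ^ 2 ≤ 32 * ((P.d : ℝ) - 1) * δ * p w ^ 2 :=
    mul_le_mul_of_nonneg_left (hp w) (by positivity)
  have h3 := (abs_le.mp h).1
  linarith

/-! ## §3  The near-flat one-sided (1.7) skeleton with LOCAL near-flatness -/

/-- ★★★ **THE SKELETON AT THE WILSON ACTION, LOCALISED** — `B16Ineq17NearFlatWilsonLetters.hessian_wilsonAction4_criticalExpChartFamily_ge_flatMin_sub` VERBATIM except that the background is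
`δ`-near-flat only on the plaquettes meeting a bond set `B₀` containing the support of the family's velocity `X′h` (`hsupp`).  This is the input the lane owner named for the assembled endpoint's
v1.2 (`hU ↦ hUloc`). [cite: Balaban1989LargeFieldII, p.357, (1.7) pp.357–358, (1.12) p.359; Balaban1985Variational, (81)–(83) p.290, (170)–(177) pp.305–306] -/
theorem hessian_wilsonAction4_criticalExpChartFamily_ge_flatMin_sub_local
    {V G : Type*} [NormedAddCommGroup V] [NormedSpace ℝ V] [NormedAddCommGroup G] [NormedSpace ℝ G]
    (U₀ : GaugeField P j (SU N)) (B₀ : Set (PBond P j)) {δ : ℝ} (hδ0 : 0 ≤ δ)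
    (hU : ∀ p : Plaq P j, ((⟨p.src, p.μ⟩ : PBond P j) ∈ B₀ ∨ (⟨p.src.shift p.μ, p.ν⟩ : PBond P j) ∈ B₀ ∨ (⟨p.src.shift p.ν, p.μ⟩ : PBond P j) ∈ B₀ ∨ (⟨p.src, p.ν⟩ : PBond P j) ∈ B₀) →
      ‖(U₀ ⟨p.src, p.μ⟩ : Matrix (Fin N) (Fin N) ℂ) - 1‖ ≤ δ ∧ ‖(U₀ ⟨p.src.shift p.μ, p.ν⟩ : Matrix (Fin N) (Fin N) ℂ) - 1‖ ≤ δ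
        ∧ ‖(U₀ ⟨p.src.shift p.ν, p.μ⟩ : Matrix (Fin N) (Fin N) ℂ) - 1‖ ≤ δ ∧ ‖(U₀ ⟨p.src, p.ν⟩ : Matrix (Fin N) (Fin N) ℂ) - 1‖ ≤ δ)
    {Ψ : (PBond P j → lieSU (Fin N)) → V} {X : G → PBond P j → lieSU (Fin N)} {g₀ : G}
    (hX₀ : X g₀ = 0) {X' : G →L[ℝ] PBond P j → lieSU (Fin N)} (hX : HasFDerivAt X X' g₀)
    {X₂ : G →L[ℝ] G →L[ℝ] PBond P j → lieSU (Fin N)} (hX₂ : HasFDerivAt (fun g => fderiv ℝ X g) X₂ g₀)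
    (hXd : ∀ᶠ g in 𝓝 g₀, DifferentiableAt ℝ X g)
    {Ψ₂ : (PBond P j → lieSU (Fin N)) →L[ℝ] (PBond P j → lieSU (Fin N)) →L[ℝ] V} (hΨ₂ : HasFDerivAt (fun Y => fderiv ℝ Ψ Y) Ψ₂ 0)
    (hΨd : ∀ᶠ Y in 𝓝 (0 : PBond P j → lieSU (Fin N)), DifferentiableAt ℝ Ψ Y)
    {lam : V →L[ℝ] ℝ} (hlam : fderiv ℝ (fun Y : PBond P j → lieSU (Fin N) => wilsonAction4 (expChart U₀ Y)) 0 = lam.comp (fderiv ℝ Ψ 0)) (h : G)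
    (hsupp : ∀ b ∉ B₀, X' h b = 0)
    (haff : lam (fderiv ℝ (fun g => fderiv ℝ (fun g => Ψ (X g)) g) g₀ h h) = 0)
    (p : Seminorm ℝ (PBond P j → lieSU (Fin N))) (hp : ∀ Y : PBond P j → lieSU (Fin N), ∑ b, ‖(Y b : Matrix (Fin N) (Fin N) ℂ)‖ ^ 2 ≤ p Y ^ 2)
    (q : V → ℝ) (Lf : (PBond P j → lieSU (Fin N)) →L[ℝ] V) {Rf : V → PBond P j → lieSU (Fin N)} {μ ρ δ₂ : ℝ} (hρ0 : 0 ≤ ρ)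
    (hRf : ∀ v, Lf (Rf v) = v) (hρ : ∀ v, p (Rf v) ≤ ρ * q v)
    (hδ₂ : q (fderiv ℝ Ψ 0 (X' h) - Lf (X' h)) ≤ δ₂ * p (X' h))
    (hμ : lam (Ψ₂ (X' h) (X' h)) ≤ μ * p (X' h) ^ 2)
    {m : ℝ} (hm : ∀ w', Lf w' = fderiv ℝ Ψ 0 (X' h) →
      m ≤ fderiv ℝ (fun Y => fderiv ℝ (fun Y : PBond P j → lieSU (Fin N) => wilsonAction4 (expChart (1 : GaugeField P j (SU N)) Y)) Y) 0 w' w') :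
    m - (32 * ((P.d : ℝ) - 1) * δ + μ + 16 * ((P.d : ℝ) - 1) * (ρ * δ₂) * (2 + ρ * δ₂)) * p (X' h) ^ 2
      ≤ fderiv ℝ (fun g => fderiv ℝ (fun g => wilsonAction4 (expChart U₀ (X g))) g) g₀ h h := by
  have hd : 0 ≤ (P.d : ℝ) - 1 := by
    have := P.hd
    have h1 : (1 : ℝ) ≤ P.d := by exact_mod_cast this
    linarith
  exact hessian_value_criticalFamily_ge_flatMin_sub_seminorm hX₀ hX hX₂ hXd (hasFDerivAt_fderiv_wilsonAction4_expChart U₀ 0)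
    (Filter.Eventually.of_forall fun Y => ((contDiff_wilsonAction4_expChart U₀).differentiable (by simp)).differentiableAt)
    hΨ₂ hΨd hlam h haff p q
    (fderiv ℝ (fun Y => fderiv ℝ (fun Y : PBond P j → lieSU (Fin N) => wilsonAction4 (expChart (1 : GaugeField P j (SU N)) Y)) Y) 0)
    Lf (β := 16 * ((P.d : ℝ) - 1)) (by positivity) hρ0 (letter_beta_wilson p hp) hRf hρ hδ₂
    (letter_delta1_wilson_local U₀ B₀ hδ0 hU p hp (X' h) hsupp) hμ hm

/-! ## §4  v1.1 (CLAIM-10): the FIRST variation at a LOCALLY near-flat background, for directions supported in `B₀` — the current letter `hj`, local edition -/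

section FirstVariationLocal

variable {P : Params} {j : ℕ} {N : ℕ} [NeZero N]

omit [NeZero N] in
/-- **BOND DEVIATIONS ⇒ PLAQUETTE DEVIATION, PER PLAQUETTE**: `|U(∂p) − 1| ≤ |U_{b₁} − 1| + |U_{b₂} − 1| + |U_{b₃} − 1| + |U_{b₄} − 1|` (four letters, two inverted; `dist1` is subadditive and
inversion invariant). [cite: Balaban1985Variational, (7) p.278 (bookkeeping); Balaban1989LargeFieldII, p.357] -/
theorem dist1_plaqHol_le_of_bonds {G : Type*} [GaugeGroup G] (V : GaugeField P j G) (p : Plaq P j) :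
    dist1 (GaugeField.plaqHol V p) ≤ dist1 (V ⟨p.src, p.μ⟩) + dist1 (V ⟨p.src.shift p.μ, p.ν⟩) + dist1 (V ⟨p.src.shift p.ν, p.μ⟩) + dist1 (V ⟨p.src, p.ν⟩) := by
  unfold GaugeField.plaqHol
  have h₁ := GaugeGroup.dist1_mul_le (V ⟨p.src, p.μ⟩ * V ⟨p.src.shift p.μ, p.ν⟩ * (V ⟨p.src.shift p.ν, p.μ⟩)⁻¹) (V ⟨p.src, p.ν⟩)⁻¹
  have h₂ := GaugeGroup.dist1_mul_le (V ⟨p.src, p.μ⟩ * V ⟨p.src.shift p.μ, p.ν⟩) (V ⟨p.src.shift p.ν, p.μ⟩)⁻¹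
  have h₃ := GaugeGroup.dist1_mul_le (V ⟨p.src, p.μ⟩) (V ⟨p.src.shift p.μ, p.ν⟩)
  rw [GaugeGroup.dist1_inv] at h₁ h₂
  linarith

/-- The same in operator-norm currency on `SU(N)` (`dist1 g = ‖↑g − 1‖`). [cite: Balaban1985Variational, (7) p.278 (bookkeeping)] -/
theorem norm_coe_plaqHol_sub_one_le_of_bonds (U : GaugeField P j (SU N)) (p : Plaq P j) :
    ‖((GaugeField.plaqHol U p : SU N) : Matrix (Fin N) (Fin N) ℂ) - 1‖
      ≤ ‖(U ⟨p.src, p.μ⟩ : Matrix (Fin N) (Fin N) ℂ) - 1‖ + ‖(U ⟨p.src.shift p.μ, p.ν⟩ : Matrix (Fin N) (Fin N) ℂ) - 1‖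
        + ‖(U ⟨p.src.shift p.ν, p.μ⟩ : Matrix (Fin N) (Fin N) ℂ) - 1‖ + ‖(U ⟨p.src, p.ν⟩ : Matrix (Fin N) (Fin N) ℂ) - 1‖ :=
  dist1_plaqHol_le_of_bonds U p

/-- ★★ **THE CURRENT LETTER `hj`, LOCAL EDITION**: if `X` vanishes off `B₀` and `‖↑U_b − 1‖ ≤ δ` on the four bonds of every plaquette meeting `B₀`, then
`|D(A∘expChart U)(0) X| ≤ 8(d−1)·δ·Σ_b ‖X_b‖` — Node00's plaquette-budget form `abs_deriv_wilsonAction4_expChart_zero_le_local` with budget `4δ` on the plaquettes meeting `B₀` (§4's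
four-letter estimate) and `2` elsewhere (unitarity; there the four letters of `X` vanish), and the incidence count `sum_plaq_boundary_eq`.
[cite: Balaban1989LargeFieldII, (1.12) p.359, p.357; Balaban1985Variational, (2) p.278; Balaban1985BackgroundPropagators, (3.7) p.391] -/
theorem abs_fderiv_wilsonAction4_expChart_apply_le_l1_local (U : GaugeField P j (SU N)) (X : PBond P j → lieSU (Fin N)) (B₀ : Set (PBond P j))
    (hX : ∀ b ∉ B₀, X b = 0) {δ : ℝ}
    (hU : ∀ p : Plaq P j, ((⟨p.src, p.μ⟩ : PBond P j) ∈ B₀ ∨ (⟨p.src.shift p.μ, p.ν⟩ : PBond P j) ∈ B₀ ∨ (⟨p.src.shift p.ν, p.μ⟩ : PBond P j) ∈ B₀ ∨ (⟨p.src, p.ν⟩ : PBond P j) ∈ B₀) →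
      ‖(U ⟨p.src, p.μ⟩ : Matrix (Fin N) (Fin N) ℂ) - 1‖ ≤ δ ∧ ‖(U ⟨p.src.shift p.μ, p.ν⟩ : Matrix (Fin N) (Fin N) ℂ) - 1‖ ≤ δ
        ∧ ‖(U ⟨p.src.shift p.ν, p.μ⟩ : Matrix (Fin N) (Fin N) ℂ) - 1‖ ≤ δ ∧ ‖(U ⟨p.src, p.ν⟩ : Matrix (Fin N) (Fin N) ℂ) - 1‖ ≤ δ) :
    |fderiv ℝ (fun Y : PBond P j → lieSU (Fin N) => wilsonAction4 (expChart U Y)) 0 X|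
      ≤ 8 * ((P.d : ℝ) - 1) * δ * ∑ b : PBond P j, ‖(X b : Matrix (Fin N) (Fin N) ℂ)‖ := by
  classical
  rw [B16Ineq17NearFlatWilsonLetters.fderiv_wilsonAction4_expChart_apply_eq_deriv]
  -- budget: `4δ` on the plaquettes meeting `B₀`, `2` elsewhere
  let bud : Plaq P j → ℝ := fun p =>
    if ((⟨p.src, p.μ⟩ : PBond P j) ∈ B₀ ∨ (⟨p.src.shift p.μ, p.ν⟩ : PBond P j) ∈ B₀ ∨ (⟨p.src.shift p.ν, p.μ⟩ : PBond P j) ∈ B₀ ∨ (⟨p.src, p.ν⟩ : PBond P j) ∈ B₀) then 4 * δ else 2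
  have htwo : ∀ p : Plaq P j, ‖((GaugeField.plaqHol U p : SU N) : Matrix (Fin N) (Fin N) ℂ) - 1‖ ≤ 2 := fun p => by
    calc ‖((GaugeField.plaqHol U p : SU N) : Matrix (Fin N) (Fin N) ℂ) - 1‖
        ≤ ‖((GaugeField.plaqHol U p : SU N) : Matrix (Fin N) (Fin N) ℂ)‖ + ‖(1 : Matrix (Fin N) (Fin N) ℂ)‖ := norm_sub_le _ _
      _ ≤ 1 + 1 := by
          gcongr
          · exact (CStarRing.norm_of_mem_unitary (GaugeField.plaqHol U p).2.1).le
          · exact norm_one.le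
      _ = 2 := by norm_num
  have hbud : ∀ p : Plaq P j, ‖((GaugeField.plaqHol U p : SU N) : Matrix (Fin N) (Fin N) ℂ) - 1‖ ≤ bud p := by
    intro p
    by_cases h : ((⟨p.src, p.μ⟩ : PBond P j) ∈ B₀ ∨ (⟨p.src.shift p.μ, p.ν⟩ : PBond P j) ∈ B₀ ∨ (⟨p.src.shift p.ν, p.μ⟩ : PBond P j) ∈ B₀ ∨ (⟨p.src, p.ν⟩ : PBond P j) ∈ B₀)
    · have hb : bud p = 4 * δ := if_pos h
      rw [hb]
      obtain ⟨h1, h2, h3, h4⟩ := hU p h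
      exact (norm_coe_plaqHol_sub_one_le_of_bonds U p).trans (by linarith)
    · have hb : bud p = 2 := if_neg h
      rw [hb]
      exact htwo p
  have hmain := abs_deriv_wilsonAction4_expChart_zero_le_local U X bud hbud
  have hterm : ∀ p : Plaq P j,
      bud p * (‖(X ⟨p.src, p.μ⟩ : Matrix (Fin N) (Fin N) ℂ)‖ + ‖(X ⟨p.src.shift p.μ, p.ν⟩ : Matrix (Fin N) (Fin N) ℂ)‖ + ‖(X ⟨p.src.shift p.ν, p.μ⟩ : Matrix (Fin N) (Fin N) ℂ)‖ + ‖(X ⟨p.src, p.ν⟩ : Matrix (Fin N) (Fin N) ℂ)‖)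
        ≤ 4 * δ * (‖(X ⟨p.src, p.μ⟩ : Matrix (Fin N) (Fin N) ℂ)‖ + ‖(X ⟨p.src.shift p.μ, p.ν⟩ : Matrix (Fin N) (Fin N) ℂ)‖ + ‖(X ⟨p.src.shift p.ν, p.μ⟩ : Matrix (Fin N) (Fin N) ℂ)‖ + ‖(X ⟨p.src, p.ν⟩ : Matrix (Fin N) (Fin N) ℂ)‖) := by
    intro p
    by_cases h : ((⟨p.src, p.μ⟩ : PBond P j) ∈ B₀ ∨ (⟨p.src.shift p.μ, p.ν⟩ : PBond P j) ∈ B₀ ∨ (⟨p.src.shift p.ν, p.μ⟩ : PBond P j) ∈ B₀ ∨ (⟨p.src, p.ν⟩ : PBond P j) ∈ B₀)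
    · have hb : bud p = 4 * δ := if_pos h
      rw [hb]
    · rw [meets_or_vanish X B₀ hX p h]
      simp
  calc |deriv (fun s : ℝ => wilsonAction4 (expChart U (s • X))) 0|
      ≤ ∑ p : Plaq P j, bud p * (‖(X ⟨p.src, p.μ⟩ : Matrix (Fin N) (Fin N) ℂ)‖ + ‖(X ⟨p.src.shift p.μ, p.ν⟩ : Matrix (Fin N) (Fin N) ℂ)‖
          + ‖(X ⟨p.src.shift p.ν, p.μ⟩ : Matrix (Fin N) (Fin N) ℂ)‖ + ‖(X ⟨p.src, p.ν⟩ : Matrix (Fin N) (Fin N) ℂ)‖) := hmain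
    _ ≤ ∑ p : Plaq P j, 4 * δ * (‖(X ⟨p.src, p.μ⟩ : Matrix (Fin N) (Fin N) ℂ)‖ + ‖(X ⟨p.src.shift p.μ, p.ν⟩ : Matrix (Fin N) (Fin N) ℂ)‖
          + ‖(X ⟨p.src.shift p.ν, p.μ⟩ : Matrix (Fin N) (Fin N) ℂ)‖ + ‖(X ⟨p.src, p.ν⟩ : Matrix (Fin N) (Fin N) ℂ)‖) := Finset.sum_le_sum fun p _ => hterm p
    _ = 4 * δ * (2 * ((P.d : ℝ) - 1) * ∑ b : PBond P j, ‖(X b : Matrix (Fin N) (Fin N) ℂ)‖) := by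
        rw [← Finset.mul_sum, sum_plaq_boundary_eq (fun b : PBond P j => ‖(X b : Matrix (Fin N) (Fin N) ℂ)‖)]
    _ = 8 * ((P.d : ℝ) - 1) * δ * ∑ b : PBond P j, ‖(X b : Matrix (Fin N) (Fin N) ℂ)‖ := by ring

/-- ★ **`letter_j_wilson`, LOCAL EDITION** (seminorm form): for `X` supported in `B₀`, a locally near-flat background as above and any seminorm `p₁` dominating the `ℓ¹(bonds)` operator-norm sum,
`|D(A∘expChart U₀)(0)X| ≤ 8(d−1)δ·p₁(X)` — the letter `hj` of the multiplier bound asked only where the knit's right inverse lives. [cite: Balaban1989LargeFieldII, (1.12) p.359, p.357; Balaban1985Variational, (82)–(83) p.290] -/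
theorem letter_j_wilson_local (U₀ : GaugeField P j (SU N)) (B₀ : Set (PBond P j)) {δ : ℝ} (hδ0 : 0 ≤ δ)
    (hU : ∀ p : Plaq P j, ((⟨p.src, p.μ⟩ : PBond P j) ∈ B₀ ∨ (⟨p.src.shift p.μ, p.ν⟩ : PBond P j) ∈ B₀ ∨ (⟨p.src.shift p.ν, p.μ⟩ : PBond P j) ∈ B₀ ∨ (⟨p.src, p.ν⟩ : PBond P j) ∈ B₀) →
      ‖(U₀ ⟨p.src, p.μ⟩ : Matrix (Fin N) (Fin N) ℂ) - 1‖ ≤ δ ∧ ‖(U₀ ⟨p.src.shift p.μ, p.ν⟩ : Matrix (Fin N) (Fin N) ℂ) - 1‖ ≤ δ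
        ∧ ‖(U₀ ⟨p.src.shift p.ν, p.μ⟩ : Matrix (Fin N) (Fin N) ℂ) - 1‖ ≤ δ ∧ ‖(U₀ ⟨p.src, p.ν⟩ : Matrix (Fin N) (Fin N) ℂ) - 1‖ ≤ δ)
    (p₁ : Seminorm ℝ (PBond P j → lieSU (Fin N))) (hp₁ : ∀ X : PBond P j → lieSU (Fin N), ∑ b, ‖(X b : Matrix (Fin N) (Fin N) ℂ)‖ ≤ p₁ X)
    (X : PBond P j → lieSU (Fin N)) (hX : ∀ b ∉ B₀, X b = 0) :
    |fderiv ℝ (fun Y : PBond P j → lieSU (Fin N) => wilsonAction4 (expChart U₀ Y)) 0 X| ≤ 8 * ((P.d : ℝ) - 1) * δ * p₁ X := by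
  have hd : 0 ≤ (P.d : ℝ) - 1 := by
    have h1 : (1 : ℝ) ≤ P.d := by exact_mod_cast P.hd
    linarith
  exact (abs_fderiv_wilsonAction4_expChart_apply_le_l1_local U₀ X B₀ hX hU).trans (mul_le_mul_of_nonneg_left (hp₁ X) (by positivity))

end FirstVariationLocal

end Literature.MathematicalPhysics.QuantumFieldTheory.Balaban1983to89.B16Ineq17NearFlatWilsonLettersLocal

end
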